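import Mathlib
import Summits.ValiantsHypothesis.ValiantsHypothesis.Theorems.DivisionGapDefs
import Literature.Computability.AlgebraicComplexity.PermanentIrreducible
import Summits.ValiantsHypothesis.ValiantsHypothesis.Theorems.DivisionGapPerCofactorDegreeReductionDominantRungs
import Summits.ValiantsHypothesis.ValiantsHypothesis.Theorems.DivisionGapPerCofactorDegreeReductionStubWindowOfRung
import Summits.ValiantsHypothesis.ValiantsHypothesis.Theorems.DivisionGapPerCofactorDegreeReductionStubDenseBlock

/-!
# `DivisionGap.PerCofactorDegreeReduction` (stmt-ValiantsHypothesis-15046), line `Sketch_ideator4`: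
dense classes and the two-factor classes in window currency (lead c10; registered stubs
`stub_denseClassRung`, `stub_twoFactorClassWindow`)

* `stub_denseClassRung` — a homogeneous cofactor `h` (all monomials of one total degree) with a
  DOMINANT monomial `u` whose support has at least `n - t` cells in every row and column forces
  `L⁺(per_m) ≤ ((n+2)(L⁺(per_n · h)+3))^k` for `m (t+1) + t ≤ n`, `2 (t+m) ≤ n`: the dense support
  carries a full `m × m` block and a matching of the complementary lines (`DenseBlock.stub_denseBlock`,
  Hall), and the dominant self rung (`DominantRungs.stub_dominantSelfRung`: isolation of `u` in its own
  support, isolated strip, block projection) applies.  Example: complements of perfect matchings.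
* `stub_twoFactorClassWindow` — the two-factor class rung in the currency of the core stub of the
  line: for `n ≥ n₀`, every torus-homogeneous `h` with entries `≤ N` through a scaled Hamiltonian
  2-factor `N • (μ_π₀ + μ_ρ₀)` has `n ≤ (log₂ n + log₂ L⁺(per_n · h) + c)^c`
  (`DominantRungs.stub_twoFactorClassHard` + `WindowOfRung.stub_windowOfRung`).

No definitions in this file. [folklore]
-/

noncomputable section

-- `Summit.ValiantsHypothesis.ValiantsHypothesis.…` is the tree's mandated single-conjunct layout
-- (Sub = Summit), so the duplicated namespace component is intended.
set_option linter.dupNamespace false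

open MvPolynomial Literature.Computability.AlgebraicComplexity
open Summit.ValiantsHypothesis.ValiantsHypothesis.Theorems.DivisionGap.PerCofactorDegreeReduction
open scoped NNReal

namespace Summit.ValiantsHypothesis.ValiantsHypothesis.Theorems.DivisionGap.PerCofactorDegreeReduction.ClassWindows

/-- **Dense class rung (registered stub `stub_denseClassRung`; glue of `DenseBlock.stub_denseBlock`
and `DominantRungs.stub_dominantSelfRung`).** [folklore] -/
theorem stub_denseClassRung :
    ∃ k : ℕ, ∀ (n t m : ℕ) (h : MvPolynomial (Fin n × Fin n) ℝ≥0) (u : (Fin n × Fin n) →₀ ℕ),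
      m * (t + 1) + t ≤ n → 2 * (t + m) ≤ n →
      u ∈ h.support →
      (∀ v ∈ h.support, v.degree = u.degree) →
      (∀ v ∈ h.support, ∀ e ∈ u.support, v e ≤ u e) →
      (∀ i : Fin n, n - t ≤ (Finset.univ.filter fun j => (i, j) ∈ u.support).card) →
      (∀ j : Fin n, n - t ≤ (Finset.univ.filter fun i => (i, j) ∈ u.support).card) →
      complexity (perPoly (Fin m) ℝ≥0) ≤
        ((n + 2) * (complexity (perPoly (Fin n) ℝ≥0 * h) + 3)) ^ k := by
  obtain ⟨k, hk⟩ := DominantRungs.stub_dominantSelfRung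
  refine ⟨k, fun n t m h u hmt htm hu hdeg hdom hrow hcol => ?_⟩
  obtain ⟨er, ec, M₀, her, hec, hblock, hM₀, hinj⟩ :=
    DenseBlock.stub_denseBlock n t m u.support hmt htm hrow hcol
  exact hk n m h u er ec M₀ hu hdeg hdom her hec hblock hM₀ hinj

/-- **Two-factor classes in window currency (registered stub `stub_twoFactorClassWindow`; glue of
`DominantRungs.stub_twoFactorClassHard` and `WindowOfRung.stub_windowOfRung`).** [folklore] -/
theorem stub_twoFactorClassWindow :
    ∃ c n₀ : ℕ, ∀ n ≥ n₀, ∀ (N : ℕ) (h : MvPolynomial (Fin n × Fin n) ℝ≥0) (π₀ ρ₀ : Equiv.Perm (Fin n)),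
      1 ≤ N → (π₀⁻¹ * ρ₀).IsCycle → (π₀⁻¹ * ρ₀).support = Finset.univ →
      (∃ τ : (Fin n →₀ ℕ) × (Fin n →₀ ℕ),
        ∀ v ∈ h.support, (Finsupp.mapDomain Prod.fst v, Finsupp.mapDomain Prod.snd v) = τ) →
      (∀ v ∈ h.support, ∀ e, v e ≤ N) →
      N • (permMonomial π₀ + permMonomial ρ₀) ∈ h.support →
      n ≤ (Nat.log 2 n + Nat.log 2 (complexity (perPoly (Fin n) ℝ≥0 * h)) + c) ^ c := by
  obtain ⟨k, hk⟩ := DominantRungs.stub_twoFactorClassHard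
  obtain ⟨c, n₀, hc⟩ := WindowOfRung.stub_windowOfRung k
  refine ⟨c, max n₀ 6, fun n hn N h π₀ ρ₀ hN hcyc hsupp hτ hbd hu => ?_⟩
  exact hc n (le_of_max_le_left hn) _
    (hk n N h π₀ ρ₀ (le_of_max_le_right hn) hN hcyc hsupp hτ hbd hu)

end Summit.ValiantsHypothesis.ValiantsHypothesis.Theorems.DivisionGap.PerCofactorDegreeReduction.ClassWindows

end
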